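import Mathlib
import Summits.Ventures.HodgeRepro2.LevelPositivity
import Summits.Ventures.HodgeRepro2.LiuOscillator
import Summits.Ventures.HodgeRepro2.T6B5Data

/-!
# T6B5Datum — Tier 6, sub-goal B5: the representation-level carriers of Liu §4.2–§4.3 over the cell's concrete
Liu types, and the shape they build

`LiuAlbaneseDatum K c χEF` carries, as DATA ONLY (no `Prop` field), the objects of Liu, *Fourier–Jacobi cycles and
arithmetic relative trace formula*, Cambridge J. Math. 9 (2021) §4.2–§4.3 (journal page layer
`paper:liu2021-fourier-jacobi-cycles-arithmetic-relative-trace-formula`, `p00NN` = journal page NN) at the level of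
actual representations: the group `G(A_F^∞)`, the adèlic oscillator representations `ω(μ, ε, χ)` indexed by the
cell's concrete `Liu.OscillatorTriple K c χEF` (p2's accepted LiuOscillator.lean), `Ω(μ)`, `Hom_E(A_K, A_μ)_ℚ`, the
isogeny classes. `shapeOf` then BUILDS p2's accepted abstract datum `Liu.AlbaneseH1Shape K c χEF` from it (levels =
the compact open subgroups, `dimInv` = the dimension of the `K`-invariants of the actual representation, etc.), so that
the B3 displays of Liu Prop. 4.13 / Thm. 4.18 / Cor. 4.20 (t6-p6, `T6B3Hyp.lean`, predicates of that datum per the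
lead's ruling R5) apply to it with NO dictionary hypothesis, and B5's output `Liu.OscillatorAdmissibleShape` (the
B3 ↔ B5 contract) is proved from the displayed Def. 4.11 alone (`T6B5Main.lean`).

Conventions (TIER4 §B5): Liu's `E` = the cell's CM field `K`, Liu's `F` = `F⁺`; the journal layer drops tildes —
Liu's `M̃_μ` (the number field of values of `μ^alg`, p0041 ll. 45–49) is carried as `Mt`.
README §8(d): uses an L-value-free non-vanishing device: NO.
-/

namespace Summit.Ventures.HodgeRepro2.T6.B5Datum

open Summit.Ventures.HodgeRepro2.LevelPositivity Summit.Ventures.HodgeRepro2.ShimuraData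
  Summit.Ventures.HodgeRepro2.T6.B5Data

universe u

/-- The representation-level carriers of Liu 2021 §4.2–§4.3 over the cell's concrete Liu types (data only; printed
symbol ↦ field, locators in the field docstrings). No field is a `Prop`: every printed property is a displayed
hypothesis (`T6B5Hyp.lean` for Def. 4.11; t6-p6's `T6B3Hyp.lean` for Prop. 4.13 / Thm. 4.18 / Cor. 4.20 over
`shapeOf`). -/
structure LiuAlbaneseDatum (K : Type u) [Field K] [NumberField K] [NumberField.IsCMField K]
    (c : Liu.IdeleConjugation K) (χEF : Liu.QuadraticCharacter K c) where
  /-- `n`, the rank of the totally definite incoherent hermitian space `V` over `A_E`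
  («Let n ⩾ 2 be an integer. Let V be a totally definite incoherent hermitian space over A_E of rank n», p0045 ll. 46–47). -/
  n : ℕ
  /-- `G(A_F^∞)`: the finite-adèlic points of `G := U(V)` («the unitary group of V, which is a reductive group over A_F»,
  p0045 ll. 51–52), carried as a topological group (a td group: Getz–Hahn Lemma 5.1.1). -/
  G : Type
  [instGroup : Group G]
  [instTop : TopologicalSpace G]
  [instTG : IsTopologicalGroup G]
  /-- «neat» as an elementwise condition on `k ∈ K` (Bergeron–Millson–Moeglin 2016 §1.4; TIER4 §B5 E15). -/
  neat : G → Prop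
  /-- Membership of an open compact subgroup `K` in the index set of the projective system `{Sh(V)_K}_K`
  («indexed by sufficiently small open compact subgroups K of G(A_F^∞)», p0045 ll. 52–54; Prop. C.5 p0109 ll. 18–22). -/
  IsIndex : OpenSubgroup G → Prop
  /-- The isomorphism classes of the adèlic oscillator representations (the `Rep` of p2's `Liu.AlbaneseH1Shape`). -/
  Rep : Type
  /-- `(μ, ε, χ) ↦ ω(μ, ε, χ)`: the class of the adèlic oscillator representation attached to an adèlic oscillator
  triple (Def. 4.11, p0046 ll. 32–61; the triples are the cell's concrete `Liu.OscillatorTriple K c χEF`). -/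
  osc : Liu.OscillatorTriple K c χEF → Rep
  /-- The underlying `ℂ`-vector space of the representation in the class `r` (for `r = osc (μ, ε, χ)`: of
  `ω(μ, ε, χ) := ⊗_v ω(μ_v, ε_v, χ_v)`, p0046 ll. 56–61). -/
  W : Rep → Type
  [instWacg : ∀ r, AddCommGroup (W r)]
  [instWmod : ∀ r, Module ℂ (W r)]
  /-- The representation of `G(A_F^∞)` in the class `r` (p0046 ll. 56–61). -/
  ω : ∀ r, Representation ℂ G (W r)
  /-- The multiplicity of the class `r` in `H^1_{B,τ'}(A_∞, ℂ)` (p0046 ll. 25–31; the `mult` of p2's datum, the object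
  of Prop. 4.13 p0047 ll. 10–22). -/
  mult : (K →+* ℂ) → Rep → ℕ
  /-- The `Gal(ℂ/ℚ)`-orbit equivalence relation on automorphic characters, through `μ^alg` («representatives of
  Gal(ℂ/ℚ)-orbits of all conjugate symplectic automorphic characters», Cor. 4.20 p0054 ll. 72–73 + p0055 ll. 5–7). -/
  galOrbit : Setoid (Liu.AutomorphicCharacter K)
  /-- The isogeny classes of abelian varieties over `E` with the product (the commutative monoid in which Cor. 4.20's
  «isogeny decomposition A_K ∼ ∏_μ A_μ^{d(μ,K)} of abelian varieties over E» is written, p0054 ll. 52–72). -/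
  IsogClass : Type
  [instIsog : CommMonoid IsogClass]
  /-- The isogeny class of `A_K := Alb_{X_K}` (p0046 l. 10). -/
  albanese : OpenSubgroup G → IsogClass
  /-- The isogeny class of `A_μ` (the abelian variety of an object `D_μ ∈ A(μ)`, Def. 4.5 p0042 ll. 8–20). -/
  cmVariety : Liu.AutomorphicCharacter K → IsogClass
  /-- `M̃_μ ⊆ ℂ`, «the subfield generated by values μ^alg(x) for x ∈ (A_E^∞)^×» (p0041 ll. 45–49). -/
  Mt : Liu.AutomorphicCharacter K → IntermediateField ℚ ℂ
  /-- `Ω(μ)` of Def. 4.16 (p0052 ll. 6–33): an `M̃_μ`-vector space with an `M̃_μ`-linear action of `G(A_F^∞)`;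
  its `ℚ`-structure is the restriction of scalars. -/
  Omega : Liu.AutomorphicCharacter K → Type
  [instOacg : ∀ μ, AddCommGroup (Omega μ)]
  [instOmod : ∀ μ, Module (Mt μ) (Omega μ)]
  [instOq : ∀ μ, Module ℚ (Omega μ)]
  [instOtower : ∀ μ, IsScalarTower ℚ (Mt μ) (Omega μ)]
  /-- The action of `G(A_F^∞)` on `Ω(μ)` («G(A_F^∞) acts M̃_μ-linearly via its action on A_∞», p0052 ll. 11–19). -/
  ρΩ : ∀ μ, Representation (Mt μ) G (Omega μ)
  /-- `Hom_E(A_K, A_μ)_ℚ` (p0052 l. 49) for the object `D_μ ∈ A(μ)` fixed by the datum, as a `ℚ`-vector space. -/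
  HomQ : OpenSubgroup G → Liu.AutomorphicCharacter K → Type
  [instHacg : ∀ L μ, AddCommGroup (HomQ L μ)]
  [instHmod : ∀ L μ, Module ℚ (HomQ L μ)]

attribute [instance] LiuAlbaneseDatum.instGroup LiuAlbaneseDatum.instTop LiuAlbaneseDatum.instTG
  LiuAlbaneseDatum.instWacg LiuAlbaneseDatum.instWmod LiuAlbaneseDatum.instIsog LiuAlbaneseDatum.instOacg
  LiuAlbaneseDatum.instOmod LiuAlbaneseDatum.instOq LiuAlbaneseDatum.instOtower LiuAlbaneseDatum.instHacg
  LiuAlbaneseDatum.instHmod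

variable {K : Type u} [Field K] [NumberField K] [NumberField.IsCMField K] {c : Liu.IdeleConjugation K}
  {χEF : Liu.QuadraticCharacter K c}

/-- The levels: the compact open subgroups of `G(A_F^∞)` («open compact subgroup K of G(A_F^∞)», p0045 l. 53),
a meet-semilattice under intersection (TIER4 §B5 Lemma B5.4). -/
def CLevel (𝓛 : LiuAlbaneseDatum K c χEF) : Type := {L : OpenSubgroup 𝓛.G // IsCompact (L : Set 𝓛.G)}

/-- The compact open subgroups form a meet-semilattice (the meet of two compact open subgroups is compact open,
TIER4 §B5 Lemma B5.4(3), accepted `isCompact_inf_of_isCompact_left`). -/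
noncomputable instance (𝓛 : LiuAlbaneseDatum K c χEF) : SemilatticeInf (CLevel 𝓛) :=
  Subtype.semilatticeInf fun L L' hL _ => isCompact_inf_of_isCompact_left L L' hL

/-- The abstract datum of p2's `Liu.AlbaneseH1Shape K c χEF` built from the representation-level carriers: the
classes are the classes of the oscillator representations (`Set.range 𝓛.osc`), the multiplicities are the carried
ones, the levels are the compact open subgroups, «sufficiently small» is `≤ K₀` for the threshold `K₀` (TIER4 §B5
Lemma B5.8 reading (SS)), `dimInv (osc t) L = dim_ℂ ω(μ, ε, χ)^L`, `omegaInvDim L μ = dim_ℚ Ω(μ)^L`,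
`homDim L μ = dim_ℚ Hom_E(A_L, A_μ)_ℚ`. The one `Prop` field of the shape that is not structural (`dimInv_anti`)
is discharged from finite-dimensionality of the invariants of the oscillator representations (`hfd`, supplied by
the displayed Def. 4.11, `T6B5Main.hfd_of`). -/
noncomputable def shapeOf (𝓛 : LiuAlbaneseDatum K c χEF)
    (hfd : ∀ (t : Liu.OscillatorTriple K c χEF) (L : OpenSubgroup 𝓛.G), IsCompact (L : Set 𝓛.G) →
      FiniteDimensional ℂ (invariants (𝓛.ω (𝓛.osc t)) (L : Subgroup 𝓛.G)))
    (K₀ : OpenSubgroup 𝓛.G) : Liu.AlbaneseH1Shape K c χEF where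
  rank := 𝓛.n
  Rep := Set.range 𝓛.osc
  decEqRep := Classical.decEq _
  osc t := ⟨𝓛.osc t, t, rfl⟩
  mult τ' r := 𝓛.mult τ' r.1
  Level := CLevel 𝓛
  levelLattice := inferInstance
  IsSmall L := L.1 ≤ K₀
  isSmall_of_le h hL := le_trans h hL
  dimInv r L := Module.finrank ℂ (invariants (𝓛.ω r.1) (L.1 : Subgroup 𝓛.G))
  dimInv_anti r {L L'} h := by
    obtain ⟨t, ht⟩ := r.2
    have : FiniteDimensional ℂ (invariants (𝓛.ω r.1) (L'.1 : Subgroup 𝓛.G)) := by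
      rw [← ht]; exact hfd t L'.1 L'.2
    exact Submodule.finrank_mono (invariants_mono (OpenSubgroup.toSubgroup_le.mpr h))
  galOrbit := 𝓛.galOrbit.r
  galOrbit_equivalence := 𝓛.galOrbit.iseqv
  IsogClass := 𝓛.IsogClass
  commMonoid := inferInstance
  albanese L := 𝓛.albanese L.1
  cmVariety := 𝓛.cmVariety
  homDim L μ := Module.finrank ℚ (𝓛.HomQ L.1 μ)
  omegaInvDim L μ := Module.finrank ℚ (invariants (𝓛.ρΩ μ) (L.1 : Subgroup 𝓛.G))

end Summit.Ventures.HodgeRepro2.T6.B5Datum
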